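import Literature.Geometry.Kaehler.SiegelTorusThetaCharacteristicActionHom
import Literature.Geometry.Kaehler.SiegelTorusEvenThetaConstants
import HarnessLib

/-!
# `Γ_g = Sp_{2g}(ℤ)` acts TRANSITIVELY on the even and on the odd theta characteristics:
# exactly two orbits on `(ℤ/2)^{2g}`, distinguished by the parity

Layer `Literature/Geometry/Kaehler`, namespace `Literature.Geometry.Kaehler.ComplexTorus` (lane
`lit-hodgefound`, Layer A4, theta-divisor row A4-17; prover seat `lit-hodgefound-p23`, row «A4-17(v)»).
Sequel of `SiegelTorusThetaCharacteristicAction.lean` (the permutation `γ_M = symplecticCharPerm hM` of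
`(ℤ/2)^{2g}` and the invariance of the parity `Σ εᵢδᵢ`) and `SiegelTorusThetaCharacteristicActionHom.lean`
(the homomorphism `symplecticCharAction : Sp_{2g}(ℤ) →* 𝔖((ℤ/2)^{2g})`).

Sources followed (held texts, read at the quoted lines). S. Grushevsky, R. Salvati Manni, *Gradients of
odd theta functions* (2004) [held `paper:arxiv-math_0310085` p0003 L77–L88]: "The group `Γ_g` acts on the
set of characteristics … This action is not transitive, in fact the parity of the characteristics is an
invariant."; S. Grushevsky, R. Salvati Manni, *Singularities of the theta divisor at points of order two*
(2009) [held `paper:arxiv-0805.4148` p0009 L38]: "the symplectic group acts transitively … on the odd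
characteristics"; Arbarello–Cornalba–Griffiths–Harris, *Geometry of Algebraic Curves I*, Appendix B
[held p0223 L13–L23]: "(***) Theorem. The global monodromy group acts transitively on `S⁺` and `S⁻`"
(`S^±` = the even / odd theta characteristics; the monodromy acts through `Sp_{2g}(ℤ/2)` by the affine
action above).

Proof formalised (elementary, by generators; the same induction on the number of coincidences
`#{m : kₘ, lₘ odd}` as the tree's `exists_riemannThetaChar_half_zero_ne_zero_of_even`): with
`T_β = (1 β; 0 1)` (`β` symmetric integral; `γ_{T_β}(k̄; l̄) = (k̄; \overline{l − βk + (β)₀})`) and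
`J = (0 −1; 1 0)` (`γ_J(ε; δ) = (δ; ε)`):
* `β = Eᵢⱼ + Eⱼᵢ` (`i ≠ j` two coincidences) lowers the number of coincidences by `2` within the orbit;
* no coincidence: `(k̄; l̄) = γ_{T_{D_l} J T_{D_k}}(0)` with `D_k = diagonal k`;
* one coincidence at `i`: `(k̄; l̄) = γ_{T_{D_l} J T_{D_k}}(ēᵢ; ēᵢ)`;
* `(ēⱼ; ēⱼ) ↦ (ēᵢ; ēᵢ)` by `T_{D_{eⱼ}} J T_{Eᵢⱼ+Eⱼᵢ} J T_{D_{eᵢ}}`;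
and the homomorphism `symplecticCharAction` composes / inverts the moves.

What is here (theorems only; no definition, no named fact, net debt `0`).

* `symplecticCharPerm_translation_sumElim_intCast` (`γ_{T_β}` on integral classes),
  `symplecticCharPerm_J_sumElim`, `symplecticCharAction_mul_apply`.
* **`exists_symplecticCharAction_zero_eq_of_even`** (every even characteristic is in the orbit of `0`),
  **`exists_symplecticCharAction_apply_eq_of_even`** (transitivity on the even characteristics),
  **`exists_symplecticCharAction_apply_eq_of_odd`** (transitivity on the odd characteristics),
  **`exists_symplecticCharAction_apply_eq_iff`** (`q ∈ Γ_g·p ↔ parity p = parity q`: exactly two orbits).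

## References

* [GrushevskySalvatiManni2004Gradients] S. Grushevsky, R. Salvati Manni, *Gradients of odd theta
  functions*, J. reine angew. Math. 573 (2004), 45–59 (arXiv:math/0310085), p. 3 L77–L88 of the held text.
* [GrushevskySalvatiManni2009HighMultiplicity] S. Grushevsky, R. Salvati Manni, *Singularities of the theta
  divisor at points of order two*, IMRN 2007:15 (arXiv:0805.4148), p0009 L38 of the held text.
* [ArbarelloCornalbaGriffithsHarris1985] E. Arbarello, M. Cornalba, P. A. Griffiths, J. Harris, *Geometry
  of Algebraic Curves I*, Grundlehren 267, Springer (1985), Appendix B, p0223 of the held text, Theorem (***).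
* [Lange2023AbelianVarietiesComplex] H. Lange, *Abelian Varieties over the Complex Numbers* (2023),
  §3.3.1 Lemma 3.3.1, §3.3.3 Thm. 3.3.9, Lemma 3.3.10.
* [MumfordTata1] D. Mumford, *Tata Lectures on Theta I*, Ch. II §5.
-/

noncomputable section

open scoped Manifold Topology
open scoped Real
open Set Function Complex Matrix Filter
open Literature.Analysis.SpecialFunctions Literature.Analysis.Complex

namespace Literature.Geometry.Kaehler

namespace ComplexTorus

open Literature.NumberTheory.Automorphic (siegelUpperHalfSpace)
open Literature.NumberTheory.ModularForms.SiegelUpperHalfSpace (moeb denom)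

variable {n : ℕ}

/-! ### §1 The generators `T_β`, `J` on characteristics; composition -/

section Generators

/-- **`γ_{T_β}(k̄; l̄) = (k̄; \overline{l − βk + (β)₀})`** for `T_β = (1 β; 0 1)`, `β` symmetric integral.
[cite: GrushevskySalvatiManni2004Gradients, p0003 L77–L84 of the held text]
[cite: Lange2023AbelianVarietiesComplex, §3.3.3 Lemma 3.3.10 (p0176)] -/
theorem symplecticCharPerm_translation_sumElim_intCast {β : Matrix (Fin n) (Fin n) ℤ} (hβ : β.IsSymm)
    (k l : Fin n → ℤ) :
    symplecticCharPerm (fromBlocks_one_symm_mem_symplecticGroup hβ)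
        (Sum.elim (fun i ↦ (k i : ZMod 2)) (fun i ↦ (l i : ZMod 2))) =
      Sum.elim (fun i ↦ (k i : ZMod 2)) (fun i ↦ (((l - β *ᵥ k + Matrix.diag β) i : ℤ) : ZMod 2)) := by
  rw [symplecticCharPerm_sumElim_intCast]
  simp only [Matrix.toBlocks_fromBlocks₁₁, Matrix.toBlocks_fromBlocks₁₂, Matrix.toBlocks_fromBlocks₂₁,
    Matrix.toBlocks_fromBlocks₂₂, Matrix.one_mulVec, Matrix.zero_mulVec, sub_zero, Matrix.zero_mul,
    Matrix.diag_zero, add_zero, Matrix.one_mul, Matrix.diag_transpose]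

/-- **`γ_J(ε; δ) = (δ; ε)`** for `J = (0 −1; 1 0)`. [cite: GrushevskySalvatiManni2004Gradients, p0003 L77–L84 of the held text]
[cite: Lange2023AbelianVarietiesComplex, §3.3.1 Lemma 3.3.1 (b) (p0170)] -/
theorem symplecticCharPerm_J_sumElim (a b : Fin n → ZMod 2) :
    symplecticCharPerm (SymplecticGroup.J_mem (Fin n) ℤ) (Sum.elim a b) = Sum.elim b a := by
  rw [symplecticCharPerm_J]
  funext s
  rcases s with i | i <;> rfl

/-- `γ_{MM'}(p) = γ_M(γ_{M'}(p))` for the homomorphism `symplecticCharAction`.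
[cite: GrushevskySalvatiManni2004Gradients, p0003 L77–L87 of the held text] -/
theorem symplecticCharAction_mul_apply (M M' : Matrix.symplecticGroup (Fin n) ℤ)
    (p : Fin n ⊕ Fin n → ZMod 2) :
    symplecticCharAction (M * M') p = symplecticCharAction M (symplecticCharAction M' p) := by
  rw [map_mul, Equiv.Perm.mul_apply]

/-- `T_β ∈ Sp_{2g}(ℤ)` as a group element. [folklore] -/
private def spT {β : Matrix (Fin n) (Fin n) ℤ} (hβ : β.IsSymm) : Matrix.symplecticGroup (Fin n) ℤ :=
  ⟨Matrix.fromBlocks 1 β 0 1, fromBlocks_one_symm_mem_symplecticGroup hβ⟩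

/-- `J ∈ Sp_{2g}(ℤ)` as a group element. [folklore] -/
private def spJ : Matrix.symplecticGroup (Fin n) ℤ :=
  ⟨Matrix.J (Fin n) ℤ, SymplecticGroup.J_mem (Fin n) ℤ⟩

/-- `γ_{T_β}` through `symplecticCharAction`. [folklore] -/
private theorem spT_apply {β : Matrix (Fin n) (Fin n) ℤ} (hβ : β.IsSymm) (k l : Fin n → ℤ) :
    symplecticCharAction (spT hβ) (Sum.elim (fun i ↦ (k i : ZMod 2)) (fun i ↦ (l i : ZMod 2))) =
      Sum.elim (fun i ↦ (k i : ZMod 2)) (fun i ↦ (((l - β *ᵥ k + Matrix.diag β) i : ℤ) : ZMod 2)) :=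
  symplecticCharPerm_translation_sumElim_intCast hβ k l

/-- `γ_J` through `symplecticCharAction`. [folklore] -/
private theorem spJ_apply (a b : Fin n → ZMod 2) :
    symplecticCharAction (spJ) (Sum.elim a b) = Sum.elim b a :=
  symplecticCharPerm_J_sumElim a b

/-- `(Eᵢⱼ + Eⱼᵢ)` is symmetric. [folklore] -/
private theorem isSymm_pairMatrix (i j : Fin n) :
    (Matrix.single i j (1 : ℤ) + Matrix.single j i 1).IsSymm := by
  unfold Matrix.IsSymm
  rw [Matrix.transpose_add, Matrix.transpose_single, Matrix.transpose_single, add_comm]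

/-- `diag(Eᵢⱼ + Eⱼᵢ) = 0` for `i ≠ j`. [folklore] -/
private theorem diag_pairMatrix {i j : Fin n} (hij : i ≠ j) :
    Matrix.diag (Matrix.single i j (1 : ℤ) + Matrix.single j i 1) = 0 := by
  funext m
  simp only [Matrix.diag_apply, Matrix.add_apply, Pi.zero_apply]
  rw [Matrix.single_apply_of_ne (h := fun h ↦ hij (h.1.trans h.2.symm)),
    Matrix.single_apply_of_ne (h := fun h ↦ hij (h.1.trans h.2.symm).symm), add_zero]

/-- `((Eᵢⱼ + Eⱼᵢ)k)ₘ = [m = i]kⱼ + [m = j]kᵢ`. [folklore] -/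
private theorem pairMatrix_mulVec_apply (i j : Fin n) (k : Fin n → ℤ) (m : Fin n) :
    ((Matrix.single i j (1 : ℤ) + Matrix.single j i 1) *ᵥ k) m =
      (if m = i then k j else 0) + (if m = j then k i else 0) := by
  rw [Matrix.add_mulVec, Pi.add_apply, Matrix.single_mulVec, Matrix.single_mulVec, one_mul, one_mul,
    Function.update_apply, Function.update_apply, Pi.zero_apply]

/-- `x̄ = 0 ∨ ȳ = 0` in `ℤ/2` unless both `x, y` are odd. [folklore] -/
private theorem intCast_eq_zero_or_of_not_odd {x y : ℤ} (h : ¬ (Odd x ∧ Odd y)) :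
    (x : ZMod 2) = 0 ∨ (y : ZMod 2) = 0 := by
  by_cases hx : Odd x
  · exact Or.inr (ZMod.intCast_eq_zero_iff_even.2 (Int.not_odd_iff_even.1 fun hy ↦ h ⟨hx, hy⟩))
  · exact Or.inl (ZMod.intCast_eq_zero_iff_even.2 (Int.not_odd_iff_even.1 hx))

/-- `x̄ = 1` in `ℤ/2` for odd `x`. [folklore] -/
private theorem intCast_eq_one_of_odd {x : ℤ} (h : Odd x) : (x : ZMod 2) = 1 := by
  obtain ⟨r, rfl⟩ := h
  push_cast
  rw [show (2 : ZMod 2) = 0 from by decide, zero_mul, zero_add]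

/-- **The pair move**: for two coincidences `i ≠ j` of `(k, l)`, `(k̄; l̄) = γ_{T_β}(k̄; \overline{l − βk})`
with `β = Eᵢⱼ + Eⱼᵢ`, and `(k, l − βk)` has the coincidences of `(k, l)` minus `{i, j}`
(`oddSupport_translate_pair`). [cite: Lange2023AbelianVarietiesComplex, §3.3.3 Lemma 3.3.10 (p0176)] -/
private theorem spT_pair_apply (i j : Fin n) (hij : i ≠ j) (k l : Fin n → ℤ) :
    symplecticCharAction (spT (isSymm_pairMatrix i j))
        (Sum.elim (fun m ↦ (k m : ZMod 2))
          (fun m ↦ (((fun m ↦ l m - ((Matrix.single i j (1 : ℤ) + Matrix.single j i 1) *ᵥ k) m) m : ℤ) :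
            ZMod 2))) =
      Sum.elim (fun m ↦ (k m : ZMod 2)) (fun m ↦ (l m : ZMod 2)) := by
  rw [spT_apply, diag_pairMatrix hij, add_zero]
  congr 1
  funext m
  simp only [Pi.sub_apply]
  push_cast
  rw [sub_sub, ← two_mul, show (2 : ZMod 2) = 0 from by decide, zero_mul, sub_zero]

end Generators

/-! ### §2 The orbit of `0`: all even characteristics -/

section Even

/-- **The base move** `B = T_{D_l} J T_{D_k}` (`D_v = diagonal v`) on integral classes:
`γ_B(ū; v̄) = (\overline{v₁}; \overline{u − D_l v₁ + l})` with `v₁ = v − D_k u + k`. [folklore] -/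
private theorem base_apply (k l u v : Fin n → ℤ) :
    symplecticCharAction (spT (Matrix.isSymm_diagonal l) * spJ * spT (Matrix.isSymm_diagonal k))
        (Sum.elim (fun m ↦ (u m : ZMod 2)) (fun m ↦ (v m : ZMod 2))) =
      Sum.elim (fun m ↦ (((fun m ↦ v m - k m * u m + k m) m : ℤ) : ZMod 2))
        (fun m ↦ (((fun m ↦ u m - l m * (v m - k m * u m + k m) + l m) m : ℤ) : ZMod 2)) := by
  have h1 : (v - Matrix.diagonal k *ᵥ u + Matrix.diag (Matrix.diagonal k)) =
      fun m ↦ v m - k m * u m + k m := by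
    funext m
    simp [Matrix.mulVec_diagonal, Matrix.diag_diagonal]
  have h2 : (u - Matrix.diagonal l *ᵥ (fun m ↦ v m - k m * u m + k m) + Matrix.diag (Matrix.diagonal l)) =
      fun m ↦ u m - l m * (v m - k m * u m + k m) + l m := by
    funext m
    simp [Matrix.mulVec_diagonal, Matrix.diag_diagonal]
  rw [symplecticCharAction_mul_apply, symplecticCharAction_mul_apply, spT_apply, h1, spJ_apply, spT_apply,
    h2]

/-- Induction on the number of coincidences (even case): every `(k̄; l̄)` with an even number of
coincidences is `γ_M(0)` for some `M ∈ Sp_{2g}(ℤ)`. [cite: ArbarelloCornalbaGriffithsHarris1985, Appendix B p0223 Theorem (***) of the held text] -/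
private theorem exists_action_zero_eq_of_even_card :
    ∀ (N : ℕ) (k l : Fin n → ℤ), (Finset.univ.filter fun m ↦ Odd (k m) ∧ Odd (l m)).card = N → Even N →
      ∃ M : Matrix.symplecticGroup (Fin n) ℤ,
        symplecticCharAction M (Sum.elim (fun _ ↦ ((0 : ℤ) : ZMod 2)) (fun _ ↦ ((0 : ℤ) : ZMod 2))) =
          Sum.elim (fun m ↦ (k m : ZMod 2)) (fun m ↦ (l m : ZMod 2)) := by
  intro N
  induction N using Nat.strong_induction_on with
  | _ N ih =>
    intro k l hcard hN
    rcases Nat.eq_zero_or_pos N with h0 | hpos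
    · -- no coincidence: the base move from `0`
      subst h0
      have hS : ∀ m, ¬ (Odd (k m) ∧ Odd (l m)) := fun m hm ↦ by
        have : m ∈ (Finset.univ.filter fun m ↦ Odd (k m) ∧ Odd (l m)) :=
          Finset.mem_filter.2 ⟨Finset.mem_univ _, hm⟩
        rw [Finset.card_eq_zero.1 hcard] at this
        exact absurd this (Finset.notMem_empty _)
      refine ⟨spT (Matrix.isSymm_diagonal l) * spJ * spT (Matrix.isSymm_diagonal k), ?_⟩
      have hb := base_apply k l (fun _ ↦ (0 : ℤ)) (fun _ ↦ (0 : ℤ))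
      simp only [mul_zero, sub_zero, zero_add, zero_sub] at hb
      rw [hb]
      congr 1
      funext m
      push_cast
      rcases intCast_eq_zero_or_of_not_odd (hS m) with h | h
      · rw [h, mul_zero, neg_zero, zero_add]
      · rw [h, zero_mul, neg_zero, zero_add]
    · -- two coincidences `i ≠ j`: the pair move
      have h2 : 2 ≤ N := by
        obtain ⟨r, hr⟩ := hN
        omega
      obtain ⟨i, hi⟩ : (Finset.univ.filter fun m ↦ Odd (k m) ∧ Odd (l m)).Nonempty :=
        Finset.card_pos.1 (hcard ▸ hpos)
      obtain ⟨j, hj, hji⟩ : ∃ j ∈ (Finset.univ.filter fun m ↦ Odd (k m) ∧ Odd (l m)), j ≠ i := by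
        have hc : 1 < ((Finset.univ.filter fun m ↦ Odd (k m) ∧ Odd (l m))).card := by omega
        exact Finset.exists_mem_ne hc i
      have hi' := (Finset.mem_filter.1 hi).2
      have hj' := (Finset.mem_filter.1 hj).2
      set l' : Fin n → ℤ := fun m ↦ l m - ((Matrix.single i j (1 : ℤ) + Matrix.single j i 1) *ᵥ k) m
        with hl'
      have hjmem : j ∈ (Finset.univ.filter fun m ↦ Odd (k m) ∧ Odd (l m)).erase i :=
        Finset.mem_erase.2 ⟨hji, hj⟩
      have hcard' : (Finset.univ.filter fun m ↦ Odd (k m) ∧ Odd (l' m)).card = N - 2 := by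
        rw [hl', oddSupport_translate_pair hji.symm k l hi' hj', Finset.card_erase_of_mem hjmem,
          Finset.card_erase_of_mem hi, hcard]
        omega
      have hN' : Even (N - 2) := by
        obtain ⟨r, hr⟩ := hN
        exact ⟨r - 1, by omega⟩
      obtain ⟨M', hM'⟩ := ih (N - 2) (by omega) k l' hcard' hN'
      refine ⟨spT (isSymm_pairMatrix i j) * M', ?_⟩
      rw [symplecticCharAction_mul_apply, hM', hl']
      exact spT_pair_apply i j hji.symm k l

/-- The zero characteristic as an integral class. [folklore] -/
private theorem zero_eq_sumElim_intCast :
    (0 : Fin n ⊕ Fin n → ZMod 2) = Sum.elim (fun _ ↦ ((0 : ℤ) : ZMod 2)) (fun _ ↦ ((0 : ℤ) : ZMod 2)) := by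
  funext s
  rcases s with i | i <;> simp

/-- **Every even characteristic is in the `Γ_g`-orbit of `0`**: for `k, l ∈ ℤ^g` with `ᵗkl` even there is
`M ∈ Sp_{2g}(ℤ)` with `γ_M(0) = (k̄; l̄)`. [cite: ArbarelloCornalbaGriffithsHarris1985, Appendix B p0223 Theorem (***) of the held text]
[cite: GrushevskySalvatiManni2004Gradients, p0003 L77–L88 of the held text] -/
theorem exists_symplecticCharAction_zero_eq_of_even (k l : Fin n → ℤ) (h : Even (k ⬝ᵥ l)) :
    ∃ M : Matrix.symplecticGroup (Fin n) ℤ,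
      symplecticCharAction M 0 = Sum.elim (fun m ↦ (k m : ZMod 2)) (fun m ↦ (l m : ZMod 2)) := by
  rw [zero_eq_sumElim_intCast]
  exact exists_action_zero_eq_of_even_card _ k l rfl ((even_dotProduct_iff_even_card_oddSupport k l).1 h)

/-- A characteristic `p ∈ (ℤ/2)^{2g}` is the class of the integral vector of its `val`s. [folklore] -/
private theorem eq_sumElim_intCast_val (p : Fin n ⊕ Fin n → ZMod 2) :
    p = Sum.elim (fun i ↦ (((((p (Sum.inl i)).val : ℕ) : ℤ)) : ZMod 2))
      (fun i ↦ (((((p (Sum.inr i)).val : ℕ) : ℤ)) : ZMod 2)) := by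
  funext s
  rcases s with i | i <;> simp

/-- **`Γ_g` acts transitively on the EVEN characteristics**: if `Σ pᵢ^ε pᵢ^δ = 0 = Σ qᵢ^ε qᵢ^δ` then
`q = γ_M(p)` for some `M ∈ Sp_{2g}(ℤ)`. [cite: ArbarelloCornalbaGriffithsHarris1985, Appendix B p0223 Theorem (***) ("acts transitively on `S⁺`") of the held text]
[cite: GrushevskySalvatiManni2004Gradients, p0003 L77–L88 of the held text] -/
theorem exists_symplecticCharAction_apply_eq_of_even {p q : Fin n ⊕ Fin n → ZMod 2}
    (hp : ∑ i, p (Sum.inl i) * p (Sum.inr i) = 0) (hq : ∑ i, q (Sum.inl i) * q (Sum.inr i) = 0) :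
    ∃ M : Matrix.symplecticGroup (Fin n) ℤ, symplecticCharAction M p = q := by
  set kp : Fin n → ℤ := fun i ↦ (((p (Sum.inl i)).val : ℕ) : ℤ) with hkp
  set lp : Fin n → ℤ := fun i ↦ (((p (Sum.inr i)).val : ℕ) : ℤ) with hlp
  set kq : Fin n → ℤ := fun i ↦ (((q (Sum.inl i)).val : ℕ) : ℤ) with hkq
  set lq : Fin n → ℤ := fun i ↦ (((q (Sum.inr i)).val : ℕ) : ℤ) with hlq
  have hp' : p = Sum.elim (fun i ↦ (kp i : ZMod 2)) (fun i ↦ (lp i : ZMod 2)) := eq_sumElim_intCast_val p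
  have hq' : q = Sum.elim (fun i ↦ (kq i : ZMod 2)) (fun i ↦ (lq i : ZMod 2)) := eq_sumElim_intCast_val q
  have hpe : Even (kp ⬝ᵥ lp) := by
    rw [← sum_intCast_mul_intCast_eq_zero_iff]
    convert hp using 2 with i
    rw [hp']
    rfl
  have hqe : Even (kq ⬝ᵥ lq) := by
    rw [← sum_intCast_mul_intCast_eq_zero_iff]
    convert hq using 2 with i
    rw [hq']
    rfl
  obtain ⟨Mp, hMp⟩ := exists_symplecticCharAction_zero_eq_of_even kp lp hpe
  obtain ⟨Mq, hMq⟩ := exists_symplecticCharAction_zero_eq_of_even kq lq hqe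
  refine ⟨Mq * Mp⁻¹, ?_⟩
  rw [symplecticCharAction_mul_apply, map_inv, Equiv.Perm.inv_eq_iff_eq.2 (hMp.trans hp'.symm).symm, hMq,
    hq']

end Even

/-! ### §3 The odd characteristics: one orbit -/

section Odd

/-- The odd characteristic `(ēᵢ; ēᵢ)` as an integral class. [folklore] -/
private theorem single_eq_intCast (i : Fin n) :
    (fun m ↦ ((Pi.single i (1 : ℤ) : Fin n → ℤ) m : ZMod 2)) =
      fun m ↦ if m = i then (1 : ZMod 2) else 0 := by
  funext m
  by_cases h : m = i
  · subst h
    simp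
  · simp [h]

/-- Induction on the number of coincidences (odd case): every `(k̄; l̄)` with an odd number of
coincidences is `γ_M(ēᵢ; ēᵢ)` for some `M ∈ Sp_{2g}(ℤ)` and some `i`.
[cite: GrushevskySalvatiManni2009HighMultiplicity, p0009 L38 of the held text]
[cite: ArbarelloCornalbaGriffithsHarris1985, Appendix B p0223 Theorem (***) of the held text] -/
private theorem exists_action_single_eq_of_odd_card :
    ∀ (N : ℕ) (k l : Fin n → ℤ), (Finset.univ.filter fun m ↦ Odd (k m) ∧ Odd (l m)).card = N → Odd N →
      ∃ M : Matrix.symplecticGroup (Fin n) ℤ, ∃ i : Fin n,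
        symplecticCharAction M
            (Sum.elim (fun m ↦ ((Pi.single i (1 : ℤ) : Fin n → ℤ) m : ZMod 2))
              (fun m ↦ ((Pi.single i (1 : ℤ) : Fin n → ℤ) m : ZMod 2))) =
          Sum.elim (fun m ↦ (k m : ZMod 2)) (fun m ↦ (l m : ZMod 2)) := by
  intro N
  induction N using Nat.strong_induction_on with
  | _ N ih =>
    intro k l hcard hN
    rcases Nat.lt_or_ge N 2 with hlt | h2
    · -- exactly one coincidence `i`: the base move from `(ēᵢ; ēᵢ)`
      have hN1 : N = 1 := by
        obtain ⟨r, hr⟩ := hN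
        omega
      subst hN1
      obtain ⟨i, hi⟩ := Finset.card_eq_one.1 hcard
      have hiS : Odd (k i) ∧ Odd (l i) := by
        have : i ∈ (Finset.univ.filter fun m ↦ Odd (k m) ∧ Odd (l m)) := by
          rw [hi]
          exact Finset.mem_singleton_self i
        exact (Finset.mem_filter.1 this).2
      have hS : ∀ m, m ≠ i → ¬ (Odd (k m) ∧ Odd (l m)) := fun m hm hodd ↦ by
        have : m ∈ (Finset.univ.filter fun m ↦ Odd (k m) ∧ Odd (l m)) :=
          Finset.mem_filter.2 ⟨Finset.mem_univ _, hodd⟩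
        rw [hi, Finset.mem_singleton] at this
        exact hm this
      refine ⟨spT (Matrix.isSymm_diagonal l) * spJ * spT (Matrix.isSymm_diagonal k), i, ?_⟩
      rw [base_apply k l (Pi.single i (1 : ℤ)) (Pi.single i (1 : ℤ))]
      have h1 : ∀ m, (((Pi.single i (1 : ℤ) : Fin n → ℤ) m - k m * (Pi.single i (1 : ℤ) : Fin n → ℤ) m +
          k m : ℤ) : ZMod 2) = (k m : ZMod 2) := by
        intro m
        by_cases hm : m = i
        · subst hm
          simp only [Pi.single_eq_same, mul_one, sub_add_cancel, Int.cast_one]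
          exact (intCast_eq_one_of_odd hiS.1).symm
        · simp [hm]
      congr 1
      · funext m
        exact h1 m
      · funext m
        by_cases hm : m = i
        · subst hm
          simp only [Pi.single_eq_same, mul_one, sub_add_cancel, Int.cast_one]
          exact (intCast_eq_one_of_odd hiS.2).symm
        · simp only [Pi.single_apply, if_neg hm, mul_zero, sub_zero, zero_sub, zero_add]
          push_cast
          rcases intCast_eq_zero_or_of_not_odd (hS m hm) with h | h
          · rw [h, mul_zero, neg_zero, zero_add]
          · rw [h, zero_mul, neg_zero, zero_add]
    · -- two coincidences `i ≠ j` among ≥ 3: the pair move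
      obtain ⟨i, hi⟩ : (Finset.univ.filter fun m ↦ Odd (k m) ∧ Odd (l m)).Nonempty :=
        Finset.card_pos.1 (by omega)
      obtain ⟨j, hj, hji⟩ : ∃ j ∈ (Finset.univ.filter fun m ↦ Odd (k m) ∧ Odd (l m)), j ≠ i := by
        have hc : 1 < ((Finset.univ.filter fun m ↦ Odd (k m) ∧ Odd (l m))).card := by omega
        exact Finset.exists_mem_ne hc i
      have hi' := (Finset.mem_filter.1 hi).2
      have hj' := (Finset.mem_filter.1 hj).2
      set l' : Fin n → ℤ := fun m ↦ l m - ((Matrix.single i j (1 : ℤ) + Matrix.single j i 1) *ᵥ k) m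
        with hl'
      have hjmem : j ∈ (Finset.univ.filter fun m ↦ Odd (k m) ∧ Odd (l m)).erase i :=
        Finset.mem_erase.2 ⟨hji, hj⟩
      have hcard' : (Finset.univ.filter fun m ↦ Odd (k m) ∧ Odd (l' m)).card = N - 2 := by
        rw [hl', oddSupport_translate_pair hji.symm k l hi' hj', Finset.card_erase_of_mem hjmem,
          Finset.card_erase_of_mem hi, hcard]
        omega
      have hN' : Odd (N - 2) := by
        obtain ⟨r, hr⟩ := hN
        exact ⟨r - 1, by omega⟩
      obtain ⟨M', i₀, hM'⟩ := ih (N - 2) (by omega) k l' hcard' hN'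
      refine ⟨spT (isSymm_pairMatrix i j) * M', i₀, ?_⟩
      rw [symplecticCharAction_mul_apply, hM', hl']
      exact spT_pair_apply i j hji.symm k l

/-- **The connecting move** `(ēⱼ; ēⱼ) ↦ (ēᵢ; ēᵢ)` (`i ≠ j`) by `T_{D_{eⱼ}} J T_{Eᵢⱼ+Eⱼᵢ} J T_{D_{eᵢ}}`.
[cite: ArbarelloCornalbaGriffithsHarris1985, Appendix B p0223 Theorem (***) of the held text] -/
private theorem exists_action_single_single {i j : Fin n} (hij : i ≠ j) :
    ∃ M : Matrix.symplecticGroup (Fin n) ℤ,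
      symplecticCharAction M
          (Sum.elim (fun m ↦ ((Pi.single j (1 : ℤ) : Fin n → ℤ) m : ZMod 2))
            (fun m ↦ ((Pi.single j (1 : ℤ) : Fin n → ℤ) m : ZMod 2))) =
        Sum.elim (fun m ↦ ((Pi.single i (1 : ℤ) : Fin n → ℤ) m : ZMod 2))
          (fun m ↦ ((Pi.single i (1 : ℤ) : Fin n → ℤ) m : ZMod 2)) := by
  set ei : Fin n → ℤ := Pi.single i (1 : ℤ) with hei
  set ej : Fin n → ℤ := Pi.single j (1 : ℤ) with hej
  set β : Matrix (Fin n) (Fin n) ℤ := Matrix.single i j (1 : ℤ) + Matrix.single j i 1 with hβ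
  refine ⟨spT (Matrix.isSymm_diagonal ej) * spJ * spT (isSymm_pairMatrix i j) * spJ *
    spT (Matrix.isSymm_diagonal ei), ?_⟩
  -- step 1: `T_{D_{eᵢ}}`: `(ēⱼ; ēⱼ) ↦ (ēⱼ; \overline{eⱼ + eᵢ})`
  have h1 : (ej - Matrix.diagonal ei *ᵥ ej + Matrix.diag (Matrix.diagonal ei)) = ei + ej := by
    funext m
    simp only [Pi.add_apply, Pi.sub_apply, Matrix.mulVec_diagonal, Matrix.diag_diagonal, hei, hej,
      Pi.single_apply]
    by_cases hmi : m = i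
    · subst hmi
      simp [if_neg hij]
    · simp [hmi]
  -- step 3: `T_β`: `(\overline{eᵢ + eⱼ}; ēⱼ) ↦ (\overline{eᵢ + eⱼ}; \overline{−eᵢ})`
  have h3 : (ej - β *ᵥ (ei + ej) + Matrix.diag β) = -ei := by
    rw [hβ, diag_pairMatrix hij, add_zero]
    funext m
    rw [Pi.sub_apply, pairMatrix_mulVec_apply, Pi.neg_apply]
    simp only [Pi.add_apply, hei, hej, Pi.single_apply, if_neg hij, if_neg (Ne.symm hij)]
    by_cases hmi : m = i
    · subst hmi
      simp [if_neg hij]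
    · by_cases hmj : m = j
      · subst hmj
        simp [hmi]
      · simp [hmi, hmj]
  -- step 5: `T_{D_{eⱼ}}`: `(\overline{−eᵢ}; \overline{eᵢ + eⱼ}) ↦ (\overline{−eᵢ}; \overline{eᵢ + 2eⱼ})`
  have h5 : ((ei + ej) - Matrix.diagonal ej *ᵥ (-ei) + Matrix.diag (Matrix.diagonal ej)) =
      fun m ↦ ei m + 2 * ej m := by
    funext m
    simp only [Pi.add_apply, Pi.sub_apply, Matrix.mulVec_diagonal, Matrix.diag_diagonal, Pi.neg_apply, hei,
      hej, Pi.single_apply]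
    by_cases hmj : m = j
    · subst hmj
      simp [if_neg (Ne.symm hij)]
    · simp [hmj]
  have hcast : ∀ v : Fin n → ℤ, (fun m ↦ ((v m : ℤ) : ZMod 2)) = fun m ↦ (((fun m ↦ v m) m : ℤ) : ZMod 2) :=
    fun v ↦ rfl
  rw [symplecticCharAction_mul_apply, symplecticCharAction_mul_apply, symplecticCharAction_mul_apply,
    symplecticCharAction_mul_apply, spT_apply, h1, spJ_apply, spT_apply, h3, spJ_apply, spT_apply, h5]
  have hfin₁ : (fun m ↦ (((-ei) m : ℤ) : ZMod 2)) = fun m ↦ ((ei m : ℤ) : ZMod 2) := by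
    funext m
    rw [Pi.neg_apply, Int.cast_neg, ZMod.neg_eq_self_mod_two]
  have hfin₂ : (fun m ↦ (((fun m ↦ ei m + 2 * ej m) m : ℤ) : ZMod 2)) = fun m ↦ ((ei m : ℤ) : ZMod 2) := by
    funext m
    simp only
    push_cast
    rw [show (2 : ZMod 2) = 0 from by decide, zero_mul, add_zero]
  rw [hfin₁, hfin₂]

/-- **`Γ_g` acts transitively on the ODD characteristics**: if `Σ pᵢ^ε pᵢ^δ = 1 = Σ qᵢ^ε qᵢ^δ` then
`q = γ_M(p)` for some `M ∈ Sp_{2g}(ℤ)`. [cite: GrushevskySalvatiManni2009HighMultiplicity, p0009 L38 ("the symplectic group acts transitively … on the odd characteristics") of the held text]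
[cite: ArbarelloCornalbaGriffithsHarris1985, Appendix B p0223 Theorem (***) ("acts transitively on `S⁻`") of the held text] -/
theorem exists_symplecticCharAction_apply_eq_of_odd {p q : Fin n ⊕ Fin n → ZMod 2}
    (hp : ∑ i, p (Sum.inl i) * p (Sum.inr i) = 1) (hq : ∑ i, q (Sum.inl i) * q (Sum.inr i) = 1) :
    ∃ M : Matrix.symplecticGroup (Fin n) ℤ, symplecticCharAction M p = q := by
  set kp : Fin n → ℤ := fun i ↦ (((p (Sum.inl i)).val : ℕ) : ℤ) with hkp
  set lp : Fin n → ℤ := fun i ↦ (((p (Sum.inr i)).val : ℕ) : ℤ) with hlp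
  set kq : Fin n → ℤ := fun i ↦ (((q (Sum.inl i)).val : ℕ) : ℤ) with hkq
  set lq : Fin n → ℤ := fun i ↦ (((q (Sum.inr i)).val : ℕ) : ℤ) with hlq
  have hp' : p = Sum.elim (fun i ↦ (kp i : ZMod 2)) (fun i ↦ (lp i : ZMod 2)) := eq_sumElim_intCast_val p
  have hq' : q = Sum.elim (fun i ↦ (kq i : ZMod 2)) (fun i ↦ (lq i : ZMod 2)) := eq_sumElim_intCast_val q
  have hpo : Odd (kp ⬝ᵥ lp) := by
    rw [← sum_intCast_mul_intCast_eq_one_iff]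
    convert hp using 2 with i
    rw [hp']
    rfl
  have hqo : Odd (kq ⬝ᵥ lq) := by
    rw [← sum_intCast_mul_intCast_eq_one_iff]
    convert hq using 2 with i
    rw [hq']
    rfl
  obtain ⟨Mp, i, hMp⟩ := exists_action_single_eq_of_odd_card _ kp lp rfl
    (Nat.not_even_iff_odd.1 fun h ↦ (Int.not_even_iff_odd.2 hpo)
      ((even_dotProduct_iff_even_card_oddSupport kp lp).2 h))
  obtain ⟨Mq, j, hMq⟩ := exists_action_single_eq_of_odd_card _ kq lq rfl
    (Nat.not_even_iff_odd.1 fun h ↦ (Int.not_even_iff_odd.2 hqo)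
      ((even_dotProduct_iff_even_card_oddSupport kq lq).2 h))
  -- connect `(ēᵢ; ēᵢ)` to `(ēⱼ; ēⱼ)`
  obtain ⟨C, hC⟩ : ∃ C : Matrix.symplecticGroup (Fin n) ℤ,
      symplecticCharAction C
          (Sum.elim (fun m ↦ ((Pi.single i (1 : ℤ) : Fin n → ℤ) m : ZMod 2))
            (fun m ↦ ((Pi.single i (1 : ℤ) : Fin n → ℤ) m : ZMod 2))) =
        Sum.elim (fun m ↦ ((Pi.single j (1 : ℤ) : Fin n → ℤ) m : ZMod 2))
          (fun m ↦ ((Pi.single j (1 : ℤ) : Fin n → ℤ) m : ZMod 2)) := by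
    by_cases hij : j = i
    · subst hij
      exact ⟨1, by rw [map_one, Equiv.Perm.one_apply]⟩
    · exact exists_action_single_single hij
  refine ⟨Mq * C * Mp⁻¹, ?_⟩
  rw [symplecticCharAction_mul_apply, symplecticCharAction_mul_apply, map_inv,
    Equiv.Perm.inv_eq_iff_eq.2 (hMp.trans hp'.symm).symm, hC, hMq, hq']

end Odd

/-! ### §4 Exactly two orbits -/

section Orbits

/-- **`Γ_g` has exactly two orbits on the `2^{2g}` characteristics, the even and the odd ones**:
`q ∈ Γ_g · p` iff `p` and `q` have the same parity `Σ εᵢδᵢ ∈ ℤ/2` ("This action is not transitive, in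
fact the parity of the characteristics is an invariant" — and it is the only one).
[cite: GrushevskySalvatiManni2004Gradients, p0003 L77–L88 of the held text]
[cite: ArbarelloCornalbaGriffithsHarris1985, Appendix B p0223 Theorem (***) of the held text] -/
theorem exists_symplecticCharAction_apply_eq_iff (p q : Fin n ⊕ Fin n → ZMod 2) :
    (∃ M : Matrix.symplecticGroup (Fin n) ℤ, symplecticCharAction M p = q) ↔
      ∑ i, p (Sum.inl i) * p (Sum.inr i) = ∑ i, q (Sum.inl i) * q (Sum.inr i) := by
  constructor
  · rintro ⟨M, rfl⟩
    rw [symplecticCharAction_apply, sum_mul_symplecticCharPerm_eq]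
  · intro h
    have h01 : ∀ x : ZMod 2, x = 0 ∨ x = 1 := by decide
    rcases h01 (∑ i, p (Sum.inl i) * p (Sum.inr i)) with h0 | h1
    · exact exists_symplecticCharAction_apply_eq_of_even h0 (h ▸ h0)
    · exact exists_symplecticCharAction_apply_eq_of_odd h1 (h ▸ h1)

/-- **No `M ∈ Sp_{2g}(ℤ)` maps an even characteristic to an odd one.**
[cite: GrushevskySalvatiManni2004Gradients, p0003 L86–L88 of the held text] -/
theorem symplecticCharAction_apply_ne_of_parity_ne {p q : Fin n ⊕ Fin n → ZMod 2}
    (h : ∑ i, p (Sum.inl i) * p (Sum.inr i) ≠ ∑ i, q (Sum.inl i) * q (Sum.inr i))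
    (M : Matrix.symplecticGroup (Fin n) ℤ) : symplecticCharAction M p ≠ q :=
  fun hM ↦ h ((exists_symplecticCharAction_apply_eq_iff p q).1 ⟨M, hM⟩)

end Orbits

end ComplexTorus

end Literature.Geometry.Kaehler

end
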